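import Literature.AlgebraicGeometry.ShimuraVarieties.SiegelBorelExtension
import Literature.AlgebraicGeometry.ShimuraVarieties.SiegelBorelExtensionPiece
import Literature.AlgebraicGeometry.ShimuraVarieties.UnitaryBallUniformisationLocalBiholomorphism
import Literature.AlgebraicGeometry.Motives.FiniteCoproductVarieties
import HarnessLib

/-!
# Borel's extension theorem between the two record systems HOLDS (assembly over the pieces)

Topic `AlgebraicGeometry/ShimuraVarieties`; namespace `Literature.AlgebraicGeometry.ShimuraVarieties`.  THEOREMS ONLY
(no definition, no named fact, no instance, no `sorry`).

★ `SiegelBorelExtension.lean` types fan-B row #61 of the cell hodgecm-mathlib as the NAMED FACT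
`siegel_borel_extension` ([Borel 1972] Thm. 3.10 / [Milne ISV] Thm. 3.14 between the complex record system of
`Sh(U(H), 𝔹²)` — source `Sc.Mc_K`, a smooth PROJECTIVE surface — and the Siegel complex record system — target
`Sg.Mc_{K_δ(N)}`, smooth quasi-projective): a point map `f : Sc.Mc_K(ℂ) → Sg.Mc_{K_δ(N)}(ℂ)` with holomorphic Siegel
lifts on the ball slices is the map on complex points of a morphism of `ℂ`-schemes.  As that file's docstring
(«Two remarks on strength», (i)) records, with a projective source Borel's extension across punctured discs is never
exercised: the statement follows from GAGA (Chow's theorem on the graph + Zariski's Main Theorem, ★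
`Transcendental.arapura2012_cor_15_4_6_holds`) applied PIECE BY PIECE to the compact ball quotients `X_q` of
`Sc.pieces K` (each `IsSmoothProjective 2`, field of ★ `UnitaryBallUniformisationDatum`).

This file is the ASSEMBLY over the pieces.  The per-piece statement — for ONE compact ball quotient
`D₂ : UnitaryBallUniformisationDatum 2 X₂` with a Sylvester frame `𝔣`, a point map `f₂ : X₂(ℂ) → Sg.Mc_{KN}(ℂ)`
which on the ball chart `D₂.ballUnifMap 𝔣` factors through one Siegel piece `q` and a holomorphic `Z : cone → 𝔥_g` is
the map on complex points of a morphism `X₂ ⟶ Sg.Mc_{KN}` — is ★ `SiegelBorelExtensionPiece.lean ::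
UnitaryBallUniformisationDatum.exists_hom_of_holomorphicSiegelLift` (node L3 of the cell's #61 table, B-p20: GAGA ★
`arapura2012_cor_15_4_6_holds` on `X₂ × ℙᵇ`, the uniformisations read as local biholomorphisms, the lift through
the immersion `Sg.Mc_{KN} ↪ ℙᵇ` ★ `ClosedGraphMorphismImmersion`); it is consumed here first as the hypothesis
`hpiece` of `siegel_borel_extension_of_piece` (the assembly, kernel-checkable without L3) and then by name in
`siegel_borel_extension_holds`.

Assembly (`siegel_borel_extension_of_piece`): given the binder block of the fact, take the pieces
`(gq, Xq, ιq, hcq, B, hB)` of `Sc.pieces K`; on the piece `q` the frame `T` of the datum is a Sylvester frame of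
`B q` (`(hB q).1 : (B q).Hℂ = H^τ` and `hT`), the slice `a := gq q` of `HasHolomorphicSiegelLift` supplies
`(q', Z)` with `Z` holomorphic on `negCone H^τ = (B q).cone`, and the third clause of `pieces`
(`(ι q)(ℂ)(unif(T·lift x)) = (pts K)⁻¹[x, gq q]`) turns the slice formula into the hypothesis of `hpiece` for
`f₂ := f ∘ (ι q)(ℂ)`; the morphisms `ψ_q : Xq q ⟶ Sg.Mc_{KN}` glue along the colimit cofan (`hcq.desc`), and every
complex point of `Sc.Mc_K` lies on a piece (★ `Motives.exists_sigmaHomeomorph_of_isColimit_cofan`).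
HC_CM is proved only modulo the 7 printed citations until rung 0 closes.

## References
* [Borel1972ExtensionTheorem] A. Borel, J. Differential Geom. 6 (1972) 543–560, Thm. 3.10 p. 559.
* [Milne2005ShimuraVarieties] J. S. Milne, *Introduction to Shimura varieties* (2005), Thm. 3.14, Thm. 5.16.
* [Mumford1981] D. Mumford, *Algebraic Geometry I: Complex Projective Varieties*, §4B (4.14) Cor. p. 67.
* [SerreGAGA1956] J.-P. Serre, GAGA, Ann. Inst. Fourier 6 (1956), §19 Prop. 13.
-/

set_option autoImplicit false

noncomputable section

open Function MulAction Topology NumberField IsDedekindDomain CategoryTheory CategoryTheory.Limits Matrix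
  AlgebraicGeometry
open scoped Matrix ComplexOrder
open Literature.AlgebraicGeometry.Motives
open Literature.NumberTheory.Automorphic Literature.NumberTheory.Automorphic.UnitaryGroup
open Literature.NumberTheory.Automorphic.ShimuraDissection
open Literature.NumberTheory.Automorphic.Liu2021.AppendixC (C5.OpenCompactSubgroup C5.SmallLevel)
open Literature.Geometry.ComplexHyperbolic Literature.Geometry.ComplexHyperbolic.BallModel
open Literature.AlgebraicGeometry.ModuliOfAbelianVarieties
open Literature.AlgebraicGeometry.HodgeTheory (IsQuasiProjectiveOver)

namespace Literature.AlgebraicGeometry.ShimuraVarieties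

open Literature.AlgebraicGeometry.ShimuraVarieties.UnitaryCanonicalModel
open Literature.AlgebraicGeometry.ShimuraVarieties.UnitaryCanonicalModel.Aux

/-- `Tᴴ A T` is the tree's `formCongr (starRingEnd ℂ) T A` (`conjTranspose = transpose ∘ map star`; the same `rfl`
as ★ `Summit.….Theorems.conjTranspose_mul_mul_eq_formCongr`, which a Literature file cannot import), so that the
frame `hT` of the hDel binder block is a Sylvester frame of every ball piece. [cite: BergeronMillsonMoeglin2016Balls, Part 2 §1.1] -/
theorem conjTranspose_mul_mul_eq_formCongr' (T : GL (Fin 3) ℂ) (A : Matrix (Fin 3) (Fin 3) ℂ) :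
    (T : Matrix (Fin 3) (Fin 3) ℂ)ᴴ * A * (T : Matrix (Fin 3) (Fin 3) ℂ) = formCongr (starRingEnd ℂ) T A :=
  rfl

/-- **Borel's extension theorem between the two record systems, from its per-piece form.**  If for every compact
ball quotient `D₂ : UnitaryBallUniformisationDatum 2 X₂` with a Sylvester frame `𝔣`, every Siegel complex record
system `Sg` (`δᵢ ≥ 1`) at a level `KN`, and every point map `f₂ : X₂(ℂ) → Sg.Mc_{KN}(ℂ)` which on the ball chart
`D₂.ballUnifMap 𝔣` is `x ↦ incl_q(unif_q(Z(𝔣.t·lift x)))` for one piece `q` and a map `Z` holomorphic on the cone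
with values in `𝔥_g` on the frame lift of the ball, `f₂` is the map on complex points of a morphism
`X₂ ⟶ Sg.Mc_{KN}` (node L3 = `UnitaryBallUniformisationDatum.exists_hom_of_holomorphicSiegelLift`), then
`siegel_borel_extension` holds: glue the per-piece morphisms along the pieces cofan of `Sc.Mc_K`.
[cite: Borel1972ExtensionTheorem, Thm. 3.10 p. 559] [cite: Milne2005ShimuraVarieties, Thm. 3.14]
[cite: Mumford1981, §4B (4.14) Corollary, p. 67] -/
theorem siegel_borel_extension_of_piece
    (hpiece : ∀ {X₂ : SchemeOver ℂ} (D₂ : UnitaryBallUniformisationDatum 2 X₂) (𝔣 : D₂.SylvesterFrame)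
      {g : ℕ} {δ : Fin g → ℕ}, (∀ i, 0 < δ i) → ∀ (Sg : SiegelComplexRecordSystem g δ) (KN : SiegelLevel δ)
      (f₂ : ComplexPoints X₂ → ComplexPoints (Sg.Mc.obj KN)) (q : Sg.Q KN)
      (Z : (Fin 3 → ℂ) → Matrix (Fin g) (Fin g) ℂ),
      (∀ i j : Fin g, DifferentiableOn ℂ (fun v => Z v i j) D₂.cone) →
      (∀ x : Ball, Z (𝔣.t *ᵥ BallModel.lift x) ∈ siegelUpperHalfSpace g) →
      (∀ x : Ball, f₂ (D₂.ballUnifMap 𝔣 x) =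
        AlgPoints.map (Sg.incl KN q) ((Sg.datum KN q).unif (Z (𝔣.t *ᵥ BallModel.lift x)))) →
      ∃ ψ : X₂ ⟶ Sg.Mc.obj KN, ∀ P : ComplexPoints X₂, AlgPoints.map ψ P = f₂ P) :
    siegel_borel_extension := by
  intro L _ _ _ H τ T hT hpos hanis K₀ htf Sc K g δ hg hδ Sg N hN f hf
  classical
  have hδpos : ∀ i, 0 < δ i := hδ.1
  -- the pieces of `Sc.Mc_K`
  obtain ⟨gq, hgq, Xq, ιq, hcq, B, hB⟩ := Sc.pieces K
  -- per piece: the frame, the slice `a := gq q`, and the per-piece morphism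
  have key : ∀ q, ∃ ψ : Xq q ⟶ Sg.Mc.obj (SiegelLevel.ofNat δ N hN),
      ∀ P : ComplexPoints (Xq q), AlgPoints.map ψ P = f (AlgPoints.map (ιq q) P) := by
    intro q
    let 𝔣 : (B q).SylvesterFrame :=
      ⟨T, by rw [(hB q).1, conjTranspose_mul_mul_eq_formCongr']; exact hT⟩
    obtain ⟨q', Z, hZd, hZx⟩ := hf (gq q)
    refine hpiece (B q) 𝔣 hδpos Sg (SiegelLevel.ofNat δ N hN) (fun P => f (AlgPoints.map (ιq q) P)) q' Z
      ?_ ?_ ?_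
    · -- holomorphy of `Z` on the cone of the piece: `(B q).cone = negCone H^τ`
      intro i j
      have hcone : (B q).cone = negCone (H.map τ) := by
        show negCone (B q).Hℂ = negCone (H.map τ)
        rw [(hB q).1]
      rw [hcone]
      exact hZd i j
    · intro x
      exact (hZx x).1
    · intro x
      have h3 := (hB q).2.2 x
      have hball : (B q).ballUnifMap 𝔣 x = (B q).unif ((T : Matrix (Fin 3) (Fin 3) ℂ) *ᵥ BallModel.lift x) := rfl
      show f (AlgPoints.map (ιq q) ((B q).ballUnifMap 𝔣 x)) = _
      rw [hball, h3]
      exact (hZx x).2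
  choose ψ hψ using key
  -- glue along the cofan and read the points summand-wise
  refine ⟨hcq.desc (Cofan.mk _ ψ), fun P => ?_⟩
  obtain ⟨Φ, hΦ⟩ := Motives.exists_sigmaHomeomorph_of_isColimit_cofan ℂ hcq
  obtain ⟨⟨q, R⟩, rfl⟩ := Φ.surjective P
  have hfac : ιq q ≫ hcq.desc (Cofan.mk _ ψ) = ψ q := hcq.fac (Cofan.mk _ ψ) ⟨q⟩
  rw [hΦ, ← AlgPoints.map_comp_apply]
  exact (congrArg (fun φ => AlgPoints.map φ R) hfac).trans (hψ q R)

/-- **Borel's extension theorem between the two record systems HOLDS** — fan-B row #61 of the cell hodgecm-mathlib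
(`siegel_borel_extension`, [Borel 1972] Thm. 3.10 / [Milne ISV] Thm. 3.14 in the tree's typed form) is a THEOREM: the
per-piece theorem ★ `UnitaryBallUniformisationDatum.exists_hom_of_holomorphicSiegelLift` (GAGA on each compact ball
quotient — the source is projective, so Borel's punctured-disc extension is never exercised, cf. the fact's docstring
«Two remarks on strength» (i)) glued along the pieces of `Sc.Mc_K` by `siegel_borel_extension_of_piece`.
[cite: Borel1972ExtensionTheorem, Thm. 3.10 p. 559] [cite: Milne2005ShimuraVarieties, Thm. 3.14, Thm. 5.16]
[cite: Mumford1981, §4B (4.14) Corollary, p. 67] [cite: SerreGAGA1956, §19 Prop. 13] -/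
theorem siegel_borel_extension_holds : siegel_borel_extension :=
  siegel_borel_extension_of_piece fun D₂ 𝔣 _ _ hδ Sg KN f₂ q Z hZ hZmem hf₂ =>
    D₂.exists_hom_of_holomorphicSiegelLift 𝔣 hδ Sg KN f₂ q Z hZ hZmem hf₂

end Literature.AlgebraicGeometry.ShimuraVarieties

end
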